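import Summits.MatrixMultiplication.MatrixMultiplication.Theorems.OutsiderSandwichPartialWeights
import Summits.MatrixMultiplication.MatrixMultiplication.Theorems.OutsiderSandwichCoreTwoByTwo
import Summits.MatrixMultiplication.MatrixMultiplication.Theorems.OutsiderSandwichAmortisedTable
import HarnessLib

/-!
# The level-`N` law: `a(N, m) ≥ ⌈3m/2⌉` from a core bound at size `2^N`

Route `OutsiderSandwich` (decomposition cell `decomp-mm`, lens 4 «minimal counterexample /
extremal reduction», gen 28, addendum 2), support for the aside leaf `BlockOneIsMM`
(stmt-MatrixMultiplication-27147).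

The level-one law `Amortised 1 B m → 3m ≤ 2B` (`OutsiderSandwichLevelOne`) is the case `N = 1`
of one pipeline that works at EVERY level `N`, with exactly one size-dependent input, a
**core bound** `c` at size `|ρ| = 2^N`: for every linear space `L` of pairs `(V, Y) ∈ M_ρ(ℂ)²`
with `V·Y = 0` on `L`, `pairRank L := dim π₁(L) + dim π₂(L) ≤ c`.  For `ρ = Fin 2`, `c = 4`
is the `2 × 2` core lemma (`pairRank_le_four`, from `finrank_range_add_le_four`).  In general
`c = |ρ|²` follows from Flanders' theorem on linear spaces of matrices of bounded rank
(H. Flanders 1962; R. Meshulam 1985: a subspace of `M_n` all of rank `≤ r` has `dim ≤ rn`)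
applied to `π₁(L)` (max rank `r`) and `π₂(L)` (rank `≤ n − r` by Zariski density) — NOT
formalised here; the core bound enters as an explicit hypothesis `hc`.

**Theorem** (`level_law`).  `1 ≤ N`, a core bound `c` at some `ρ ≃ (Fin N → Fin 2)`, and
`⟨B⟩ ⊠ C₁^{⊠N} ⊵ ⟨m⟩ ⊠ ⟨2,2,2⟩^{⊠N}` imply `4m·4^N ≤ m·c + 2B·4^N`; with the full core bound
`c = 4^N` this is `3m ≤ 2B` (`three_mul_le_two_mul_of_core`), and ANY core bound `c < 2·4^N`
gives a non-trivial amortised floor `B/m ≥ 2 − c/(2·4^N)` (e.g. Dieudonné's bound on singular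
subspaces, `c = 2(4^N − 2^N)`, would give `a(N,m) ≥ m(1 + 2^{-N})`).

Proof.  Flatten `⟨2,2,2⟩^{⊠N} ≅ ⟨2^N, 2^N, 2^N⟩` (`tgt_restrictsTo_flatT`), so the input slices
act blockwise as `Y ↦ V·Y` on `M_ρ(ℂ)^m` (`slice_flatT_mulVec`).  Partial-weight transport
(`exists_partial_weights`, formats `m·4^N, m·4^N` against `B·4^N`) gives `W` with
`dim W ≥ 2m·4^N − B·4^N`, `Y` injective on `W`, `V_i·Y_i(V) = 0`; the core bound per block and the
two injections `W ↪ ∏ range(V ↦ V_i)`, `W ↪ ∏ range(V ↦ Y_i(V))` give `2·dim W ≤ m·4^N`.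
Hence `(3m − 2B)·4^N ≤ 0`.  Consequences: the full core bound at `Fin N → Fin 2` gives
`3m ≤ 2·a(N,m)` (`three_mul_le_two_mul_amortisedNumber`); at level one it holds
(`three_mul_le_two_mul_amortisedNumber_one`, re-deriving `OutsiderSandwichLevelOne`); at level
two `a(2,3) ≥ 5`, `a(2,4) ≥ 6` conditionally on the `4 × 4` core bound (`level_two_of_core`).
Unconditionally known: `a(2,1) = 2`, `a(2,2) ∈ [3,5]` — consistent with the law.

## References
* D. Coppersmith, S. Winograd, *Matrix multiplication via arithmetic progressions*,
  J. Symbolic Comput. 9 (1990) 251–280, §7 (the coupled block `C₁`). [CoppersmithWinograd1990]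
* P. Bürgisser, M. Clausen, M. A. Shokrollahi, *Algebraic Complexity Theory*, Springer (1997),
  §14.4, §17.1 (restriction, conciseness, substitution / rank arguments).
  [BurgisserClausenShokrollahi1997]
-/

noncomputable section
open scoped BigOperators Matrix
set_option linter.dupNamespace false
set_option autoImplicit false

namespace Summit.MatrixMultiplication.MatrixMultiplication.Theorems.OutsiderSandwichLevelLaw

open Literature.Computability.AlgebraicComplexity
open Summit.MatrixMultiplication.MatrixMultiplication.Theorems.OutsiderSandwichNoTightExchange
open Summit.MatrixMultiplication.MatrixMultiplication.Theorems.OutsiderSandwichAmortisedTable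
open Summit.MatrixMultiplication.MatrixMultiplication.Theorems.OutsiderSandwichPartialWeights
open Summit.MatrixMultiplication.MatrixMultiplication.Theorems.OutsiderSandwichCoreTwoByTwo

/-! ## 1. Pair rank and the core bound -/

section Core

variable (ρ : Type)

/-- `pairRank L = dim π₁(L) + dim π₂(L)` for a space `L` of pairs of `ρ × ρ` matrices.
[cite: BurgisserClausenShokrollahi1997, §17.1] -/
def pairRank (L : Submodule ℂ (Matrix ρ ρ ℂ × Matrix ρ ρ ℂ)) : ℕ :=
  Module.finrank ℂ (L.map (LinearMap.fst ℂ (Matrix ρ ρ ℂ) (Matrix ρ ρ ℂ))) +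
    Module.finrank ℂ (L.map (LinearMap.snd ℂ (Matrix ρ ρ ℂ) (Matrix ρ ρ ℂ)))

variable {ρ}

/-- `pairRank` of the graph-range of `(p, q)` is `dim range p + dim range q`.
[cite: BurgisserClausenShokrollahi1997, §17.1] -/
theorem pairRank_range_prod {U : Type} [AddCommGroup U] [Module ℂ U]
    (p q : U →ₗ[ℂ] Matrix ρ ρ ℂ) :
    pairRank ρ (LinearMap.range (p.prod q)) =
      Module.finrank ℂ (LinearMap.range p) + Module.finrank ℂ (LinearMap.range q) := by
  unfold pairRank
  rw [← LinearMap.range_comp, ← LinearMap.range_comp, LinearMap.fst_prod, LinearMap.snd_prod]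

/-- A core bound `c` (on annihilated pair spaces) in `p, q` form.
[cite: BurgisserClausenShokrollahi1997, §17.1] -/
theorem core_apply [Fintype ρ] {c : ℕ}
    (hc : ∀ L : Submodule ℂ (Matrix ρ ρ ℂ × Matrix ρ ρ ℂ), (∀ x ∈ L, x.1 * x.2 = 0) →
      pairRank ρ L ≤ c)
    {U : Type} [AddCommGroup U] [Module ℂ U] (p q : U →ₗ[ℂ] Matrix ρ ρ ℂ)
    (hpq : ∀ u, p u * q u = 0) :
    Module.finrank ℂ (LinearMap.range p) + Module.finrank ℂ (LinearMap.range q) ≤ c := by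
  have h := hc (LinearMap.range (p.prod q)) (by
    rintro x ⟨u, rfl⟩
    exact hpq u)
  rwa [pairRank_range_prod] at h

/-- **The full core bound at size `2`** (the `2 × 2` core lemma): an annihilated pair space of
`2 × 2` matrices has `pairRank ≤ 4`. [cite: BurgisserClausenShokrollahi1997, §17.1] -/
theorem pairRank_le_four (L : Submodule ℂ (Matrix (Fin 2) (Fin 2) ℂ × Matrix (Fin 2) (Fin 2) ℂ))
    (hL : ∀ x ∈ L, x.1 * x.2 = 0) : pairRank (Fin 2) L ≤ 4 := by
  have h := finrank_range_add_le_four ((LinearMap.fst ℂ _ _).comp L.subtype)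
    ((LinearMap.snd ℂ _ _).comp L.subtype) (fun u => hL u u.2)
  rw [LinearMap.range_comp, LinearMap.range_comp, Submodule.range_subtype] at h
  exact h

end Core

/-! ## 2. The block count -/

section Blocks

variable (ρ : Type) [Fintype ρ] (m : ℕ)

/-- **Block count**: with a per-block core bound `c`, a subspace `U ≤ M_ρ(ℂ)^m` carrying a linear
`Y`, injective on `U`, with `V_i·Y(V)_i = 0`, has `2·dim U ≤ m·c`.
[cite: BurgisserClausenShokrollahi1997, §17.1] -/
theorem two_mul_finrank_le {c : ℕ} (U : Submodule ℂ (Fin m → Matrix ρ ρ ℂ))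
    (Y : (Fin m → Matrix ρ ρ ℂ) →ₗ[ℂ] (Fin m → Matrix ρ ρ ℂ))
    (hinj : ∀ u ∈ U, Y u = 0 → u = 0) (hann : ∀ u ∈ U, ∀ i, u i * Y u i = 0)
    (hcore : ∀ p q : U →ₗ[ℂ] Matrix ρ ρ ℂ, (∀ u, p u * q u = 0) →
      Module.finrank ℂ (LinearMap.range p) + Module.finrank ℂ (LinearMap.range q) ≤ c) :
    2 * Module.finrank ℂ U ≤ m * c := by
  classical
  let p : Fin m → (U →ₗ[ℂ] Matrix ρ ρ ℂ) := fun i => (LinearMap.proj i).comp U.subtype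
  let q : Fin m → (U →ₗ[ℂ] Matrix ρ ρ ℂ) := fun i => (LinearMap.proj i).comp (Y.comp U.subtype)
  have hp : ∀ i (u : U), p i u = (u : Fin m → Matrix ρ ρ ℂ) i := fun _ _ => rfl
  have hq : ∀ i (u : U), q i u = Y (u : Fin m → Matrix ρ ρ ℂ) i := fun _ _ => rfl
  have hpq : ∀ i (u : U), p i u * q i u = 0 := fun i u => by
    rw [hp, hq]; exact hann u u.2 i
  have per : ∀ i, Module.finrank ℂ (LinearMap.range (p i)) +
      Module.finrank ℂ (LinearMap.range (q i)) ≤ c := fun i => hcore (p i) (q i) (hpq i)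
  let Φ₁ : U →ₗ[ℂ] ((i : Fin m) → LinearMap.range (q i)) :=
    LinearMap.pi fun i => (q i).rangeRestrict
  have hΦ₁ : Function.Injective Φ₁ := by
    refine (injective_iff_map_eq_zero Φ₁).2 fun u hu => ?_
    have hY : Y (u : Fin m → Matrix ρ ρ ℂ) = 0 := by
      funext i
      have := congrFun hu i
      rw [LinearMap.pi_apply, Pi.zero_apply] at this
      have := congrArg Subtype.val this
      rw [LinearMap.codRestrict_apply] at this
      exact this
    exact Subtype.ext (hinj u u.2 hY)
  let Φ₂ : U →ₗ[ℂ] ((i : Fin m) → LinearMap.range (p i)) :=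
    LinearMap.pi fun i => (p i).rangeRestrict
  have hΦ₂ : Function.Injective Φ₂ := by
    refine (injective_iff_map_eq_zero Φ₂).2 fun u hu => ?_
    apply Subtype.ext
    funext i
    have := congrFun hu i
    rw [LinearMap.pi_apply, Pi.zero_apply] at this
    have := congrArg Subtype.val this
    rw [LinearMap.codRestrict_apply] at this
    exact this
  have h1 := LinearMap.finrank_le_finrank_of_injective hΦ₁
  have h2 := LinearMap.finrank_le_finrank_of_injective hΦ₂
  rw [Module.finrank_pi_fintype ℂ] at h1 h2
  have hsum : ∑ i : Fin m, (Module.finrank ℂ (LinearMap.range (p i)) +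
      Module.finrank ℂ (LinearMap.range (q i))) ≤ ∑ _i : Fin m, c :=
    Finset.sum_le_sum fun i _ => per i
  rw [Finset.sum_add_distrib, Finset.sum_const, Finset.card_univ, Fintype.card_fin,
    smul_eq_mul] at hsum
  omega

end Blocks

/-! ## 3. The flat target `⟨m⟩ ⊠ ⟨ρ, ρ, ρ⟩` -/

section Flat

variable (ρ : Type) [DecidableEq ρ] (m : ℕ)

/-- Matrix multiplication `⟨ρ,ρ,ρ⟩` as a tensor on `(ρ × ρ)³` (tree convention `Z = XY`).
[cite: BurgisserClausenShokrollahi1997, §14.4] -/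
def mmT : ρ × ρ → ρ × ρ → ρ × ρ → ℂ :=
  fun x y z => if x.1 = y.1 ∧ y.2 = z.1 ∧ x.2 = z.2 then 1 else 0

/-- `⟨m⟩ ⊠ ⟨ρ,ρ,ρ⟩` on `Fin m × (ρ × ρ)`. [cite: BurgisserClausenShokrollahi1997, §14.4] -/
abbrev flatT : Fin m × (ρ × ρ) → Fin m × (ρ × ρ) → Fin m × (ρ × ρ) → ℂ :=
  kroneckerTensor (unitTensor ℂ m) (mmT ρ)

/-- **Flattening** `⟨m⟩ ⊠ ⟨2,2,2⟩^{⊠N} ⊵ ⟨m⟩ ⊠ ⟨ρ,ρ,ρ⟩` along `ρ ≃ (Fin N → Fin 2)`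
(in fact an isomorphism). [cite: BurgisserClausenShokrollahi1997, §14.4] -/
theorem tgt_restrictsTo_flatT {N : ℕ} (e : (Fin N → Fin 2) ≃ ρ) :
    TensorRestrictsTo (tgt N m) (flatT ρ m) := by
  classical
  let f : Fin m × (ρ × ρ) → J N m :=
    fun a => (a.1, fun j => (e.symm a.2.1 j, e.symm a.2.2 j))
  have hM : ∀ (x y z : Fin 2 × Fin 2), matMulTensor ℂ 2 2 2 x y z =
      if x.1 = y.1 ∧ y.2 = z.1 ∧ x.2 = z.2 then 1 else 0 := fun _ _ _ => rfl
  have hfun : flatT ρ m = fun a b c => tgt N m (f a) (f b) (f c) := by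
    funext a b c
    dsimp only [flatT, tgt, f, mmT]
    rw [kroneckerTensor_apply, kroneckerTensor_apply, kroneckerPow_apply]
    congr 1
    simp only [mmT, hM, Fintype.prod_boole, forall_and, ← funext_iff, Equiv.apply_eq_iff_eq]
  rw [hfun]
  exact tensorRestrictsTo_precomp (tgt N m) f f f

variable [Fintype ρ]

/-- Entries of the input slices of `flatT`. [cite: BurgisserClausenShokrollahi1997, §14.4] -/
theorem slice_flatT_apply (w : Fin m × (ρ × ρ) → ℂ) (a c : Fin m × (ρ × ρ)) :
    slice (flatT ρ m) w a c =
      if c.2.2 = a.2.2 ∧ c.1 = a.1 then w (a.1, (a.2.1, c.2.1)) else 0 := by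
  rw [slice_apply, Finset.sum_eq_single (a.1, (a.2.1, c.2.1))]
  · dsimp only [flatT]
    rw [kroneckerTensor_apply, unitTensor_apply]
    dsimp only [mmT]
    by_cases h : c.2.2 = a.2.2 ∧ c.1 = a.1
    · rw [if_pos h, if_pos ⟨rfl, h.2.symm⟩, if_pos ⟨rfl, rfl, h.1.symm⟩, mul_one, mul_one]
    · rw [if_neg h]
      by_cases h1 : c.1 = a.1
      · have h2 : ¬ c.2.2 = a.2.2 := fun h2 => h ⟨h2, h1⟩
        rw [if_pos ⟨rfl, h1.symm⟩, one_mul, if_neg (fun hh => h2 hh.2.2.symm), mul_zero]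
      · rw [if_neg (fun hh => h1 hh.2.symm), zero_mul, mul_zero]
  · intro b _ hb
    dsimp only [flatT]
    rw [kroneckerTensor_apply, unitTensor_apply]
    dsimp only [mmT]
    by_cases h1 : a.1 = b.1 ∧ b.1 = c.1
    · rw [if_pos h1, one_mul]
      by_cases h2 : a.2.1 = b.2.1 ∧ b.2.2 = c.2.1 ∧ a.2.2 = c.2.2
      · exfalso; apply hb
        exact Prod.ext h1.1.symm (Prod.ext h2.1.symm h2.2.1)
      · rw [if_neg h2, mul_zero]
    · rw [if_neg h1, zero_mul, mul_zero]
  · intro h; exact absurd (Finset.mem_univ _) h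

/-- The input slices of `flatT` act blockwise as `Y ↦ V·Y`.
[cite: BurgisserClausenShokrollahi1997, §14.4] -/
theorem slice_flatT_mulVec (w ζ : Fin m × (ρ × ρ) → ℂ) (i : Fin m) (p q : ρ) :
    (slice (flatT ρ m) w).mulVec ζ (i, (p, q)) = ∑ j : ρ, w (i, (p, j)) * ζ (i, (j, q)) := by
  simp only [Matrix.mulVec, dotProduct, slice_flatT_apply, ite_mul, zero_mul,
    Fintype.sum_prod_type]
  simp only [ite_and, Finset.sum_ite_eq', Finset.mem_univ, if_true]
  rw [Finset.sum_comm]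
  simp only [Finset.sum_ite_eq', Finset.mem_univ, if_true]

/-- `flatT` is input-concise in slice form. [cite: BurgisserClausenShokrollahi1997, §14.4] -/
theorem flatT_weight_eq_zero (w : Fin m × (ρ × ρ) → ℂ) (h : slice (flatT ρ m) w = 0) :
    w = 0 := by
  funext x
  obtain ⟨i, p, j⟩ := x
  have e := congrFun (congrFun h (i, (p, j))) (i, (j, j))
  rw [slice_flatT_apply, if_pos ⟨rfl, rfl⟩, Matrix.zero_apply] at e
  exact e

/-- `flatT` is output-concise in slice form. [cite: BurgisserClausenShokrollahi1997, §14.4] -/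
theorem flatT_vec_eq_zero (ζ : Fin m × (ρ × ρ) → ℂ)
    (h : ∀ w, (slice (flatT ρ m) w).mulVec ζ = 0) : ζ = 0 := by
  funext x
  obtain ⟨i, p, q⟩ := x
  have e := congrFun (h fun b => if b.2.1 = b.2.2 then 1 else 0) (i, (p, q))
  rw [slice_flatT_mulVec, Pi.zero_apply] at e
  simp only [ite_mul, one_mul, zero_mul, Finset.sum_ite_eq, Finset.mem_univ, if_true] at e
  exact e

/-- Blocks: the flat weight/output space as `m`-tuples of `ρ × ρ` matrices.
[cite: BurgisserClausenShokrollahi1997, §14.4] -/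
def blocksT : (Fin m × (ρ × ρ) → ℂ) ≃ₗ[ℂ] (Fin m → Matrix ρ ρ ℂ) where
  toFun v := fun i => Matrix.of fun p j => v (i, (p, j))
  invFun V := fun b => V b.1 b.2.1 b.2.2
  map_add' v v' := by funext i; ext p j; rfl
  map_smul' c v := by funext i; ext p j; rfl
  left_inv v := by funext b; rfl
  right_inv V := by funext i; ext p j; rfl

/-- Block products are the slice action. [cite: BurgisserClausenShokrollahi1997, §14.4] -/
theorem blocksT_mul_blocksT (w ζ : Fin m × (ρ × ρ) → ℂ) (i : Fin m) (p q : ρ) :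
    (blocksT ρ m w i * blocksT ρ m ζ i) p q = (slice (flatT ρ m) w).mulVec ζ (i, (p, q)) := by
  rw [slice_flatT_mulVec, Matrix.mul_apply]
  rfl

end Flat

/-! ## 4. The law -/

/-- `|J N B| = B·4^N`. [cite: BurgisserClausenShokrollahi1997, §14.4] -/
theorem card_J (N B : ℕ) : Fintype.card (J N B) = B * (2 ^ N * 2 ^ N) := by
  rw [Fintype.card_prod, Fintype.card_fun, Fintype.card_prod, Fintype.card_fin, Fintype.card_fin,
    Fintype.card_fin, mul_pow]

/-- **Level-`N` law from a core bound `c`**: `1 ≤ N`, `ρ ≃ (Fin N → Fin 2)`, every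
annihilated pair space of `ρ × ρ` matrices has `pairRank ≤ c`, and
`⟨B⟩ ⊠ C₁^{⊠N} ⊵ ⟨m⟩ ⊠ ⟨2,2,2⟩^{⊠N}`; then `4m·4^N ≤ m·c + 2B·4^N`.
[cite: CoppersmithWinograd1990, §7] -/
theorem level_law {N B m c : ℕ} (hN : 1 ≤ N) {ρ : Type} [Fintype ρ] [DecidableEq ρ]
    (e : (Fin N → Fin 2) ≃ ρ)
    (hc : ∀ L : Submodule ℂ (Matrix ρ ρ ℂ × Matrix ρ ρ ℂ), (∀ x ∈ L, x.1 * x.2 = 0) →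
      pairRank ρ L ≤ c)
    (h : Amortised N B m) : 4 * m * 4 ^ N ≤ m * c + 2 * B * 4 ^ N := by
  have hres : TensorRestrictsTo (src N B) (flatT ρ m) :=
    ((src_restrictsTo_coupling N B).trans h).trans (tgt_restrictsTo_flatT ρ m e)
  obtain ⟨W, Y, hdim, hinj, hann⟩ :=
    exists_partial_weights hN (flatT_weight_eq_zero ρ m) (flatT_vec_eq_zero ρ m) hres
  let Θ := blocksT ρ m
  let U : Submodule ℂ (Fin m → Matrix ρ ρ ℂ) := W.map (Θ : _ →ₗ[ℂ] _)
  let Yb : (Fin m → Matrix ρ ρ ℂ) →ₗ[ℂ] (Fin m → Matrix ρ ρ ℂ) :=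
    (Θ : _ →ₗ[ℂ] _) ∘ₗ Y ∘ₗ (Θ.symm : _ →ₗ[ℂ] _)
  have hYb : ∀ w, Yb (Θ w) = Θ (Y w) := fun w => by
    simp only [Yb, LinearMap.comp_apply, LinearEquiv.coe_coe, LinearEquiv.symm_apply_apply]
  have hU : ∀ u ∈ U, ∃ w ∈ W, Θ w = u := fun u hu => Submodule.mem_map.1 hu
  have hinj' : ∀ u ∈ U, Yb u = 0 → u = 0 := by
    intro u hu h0
    obtain ⟨w, hw, rfl⟩ := hU u hu
    rw [hYb, LinearEquiv.map_eq_zero_iff] at h0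
    rw [hinj w hw h0, map_zero]
  have hann' : ∀ u ∈ U, ∀ i, u i * Yb u i = 0 := by
    intro u hu i
    obtain ⟨w, hw, rfl⟩ := hU u hu
    rw [hYb]
    ext p q
    rw [Matrix.zero_apply]
    change (blocksT ρ m w i * blocksT ρ m (Y w) i) p q = 0
    rw [blocksT_mul_blocksT, hann w hw, Pi.zero_apply]
  have hcore := two_mul_finrank_le ρ m U Yb hinj' hann' (fun p q hpq => core_apply hc p q hpq)
  have hfin : Module.finrank ℂ U = Module.finrank ℂ W := LinearEquiv.finrank_map_eq Θ W
  obtain ⟨K, hK⟩ : ∃ K, 2 ^ N * 2 ^ N = K := ⟨_, rfl⟩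
  have h4 : 4 ^ N = K := by
    rw [← hK, ← mul_pow]
    norm_num
  have hρ : Fintype.card ρ ^ 2 = K := by
    rw [← Fintype.card_congr e, Fintype.card_fun, Fintype.card_fin, Fintype.card_fin, pow_two,
      hK]
  have hc1 : Fintype.card (Fin m × (ρ × ρ)) = m * K := by
    rw [Fintype.card_prod, Fintype.card_prod, ← pow_two, hρ, Fintype.card_fin]
  rw [hc1, card_J, hK] at hdim
  rw [hfin] at hcore
  rw [mul_assoc, mul_assoc, h4]
  omega

/-- **The law with the full core bound**: `pairRank ≤ |ρ|²` on annihilated pair spaces at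
`ρ ≃ (Fin N → Fin 2)` and `⟨B⟩ ⊠ C₁^{⊠N} ⊵ ⟨m⟩ ⊠ ⟨2,2,2⟩^{⊠N}` imply `3m ≤ 2B`, i.e.
`a(N,m) ≥ ⌈3m/2⌉`. [cite: CoppersmithWinograd1990, §7] -/
theorem three_mul_le_two_mul_of_core {N B m : ℕ} (hN : 1 ≤ N) {ρ : Type} [Fintype ρ]
    [DecidableEq ρ] (e : (Fin N → Fin 2) ≃ ρ)
    (hc : ∀ L : Submodule ℂ (Matrix ρ ρ ℂ × Matrix ρ ρ ℂ), (∀ x ∈ L, x.1 * x.2 = 0) →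
      pairRank ρ L ≤ Fintype.card ρ ^ 2)
    (h : Amortised N B m) : 3 * m ≤ 2 * B := by
  have h1 := level_law hN e hc h
  obtain ⟨K, hK⟩ : ∃ K, 4 ^ N = K := ⟨_, rfl⟩
  have hKpos : 0 < K := by rw [← hK]; positivity
  have hρ : Fintype.card ρ ^ 2 = K := by
    rw [← Fintype.card_congr e, Fintype.card_fun, Fintype.card_fin, Fintype.card_fin, ← pow_mul,
      mul_comm, pow_mul, ← hK]
    norm_num
  rw [hρ, hK] at h1
  have key : 3 * (m * K) ≤ 2 * (B * K) := by
    simp only [mul_assoc] at h1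
    omega
  exact Nat.le_of_mul_le_mul_right (by simpa only [mul_assoc] using key) hKpos

/-- The full core bound at `Fin N → Fin 2` gives `3m ≤ 2·a(N, m)`.
[cite: CoppersmithWinograd1990, §7] -/
theorem three_mul_le_two_mul_amortisedNumber {N : ℕ} (hN : 1 ≤ N)
    (hc : ∀ L : Submodule ℂ (Matrix (Fin N → Fin 2) (Fin N → Fin 2) ℂ ×
        Matrix (Fin N → Fin 2) (Fin N → Fin 2) ℂ), (∀ x ∈ L, x.1 * x.2 = 0) →
      pairRank (Fin N → Fin 2) L ≤ Fintype.card (Fin N → Fin 2) ^ 2)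
    (m : ℕ) : 3 * m ≤ 2 * amortisedNumber N m :=
  three_mul_le_two_mul_of_core hN (Equiv.refl _) hc (amortised_amortisedNumber N m)

/-- **Level one through the general pipeline**: flatten along `Fin 2 ≃ (Fin 1 → Fin 2)` and use
the `2 × 2` core lemma: `3m ≤ 2·a(1, m)` (the lower half of `a(1,m) = ⌈3m/2⌉`).
[cite: CoppersmithWinograd1990, §7] -/
theorem three_mul_le_two_mul_amortisedNumber_one (m : ℕ) : 3 * m ≤ 2 * amortisedNumber 1 m :=
  three_mul_le_two_mul_of_core (le_refl 1) (Equiv.funUnique (Fin 1) (Fin 2))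
    (fun L hL => (pairRank_le_four L hL).trans (by simp)) (amortised_amortisedNumber 1 m)

/-- **Level two, conditionally on the `4 × 4` core bound**: `⟨4⟩ ⊠ C₁^{⊠2} ⋭ ⟨3⟩ ⊠ ⟨2,2,2⟩^{⊠2}`,
`a(2,3) ≥ 5`, `a(2,4) ≥ 6` (unconditionally known: `a(2,1) = 2`, `3 ≤ a(2,2) ≤ 5`).
[cite: CoppersmithWinograd1990, §7] -/
theorem level_two_of_core
    (hc : ∀ L : Submodule ℂ (Matrix (Fin 2 → Fin 2) (Fin 2 → Fin 2) ℂ ×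
        Matrix (Fin 2 → Fin 2) (Fin 2 → Fin 2) ℂ), (∀ x ∈ L, x.1 * x.2 = 0) →
      pairRank (Fin 2 → Fin 2) L ≤ Fintype.card (Fin 2 → Fin 2) ^ 2) :
    ¬ Amortised 2 4 3 ∧ 5 ≤ amortisedNumber 2 3 ∧ 6 ≤ amortisedNumber 2 4 := by
  have h3 := three_mul_le_two_mul_amortisedNumber (by norm_num : 1 ≤ 2) hc 3
  have h4 := three_mul_le_two_mul_amortisedNumber (by norm_num : 1 ≤ 2) hc 4
  refine ⟨fun h => ?_, by omega, by omega⟩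
  have := three_mul_le_two_mul_of_core (by norm_num : 1 ≤ 2) (Equiv.refl _) hc h
  omega

end Summit.MatrixMultiplication.MatrixMultiplication.Theorems.OutsiderSandwichLevelLaw
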